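import Summits.RiemannHypothesis.RiemannHypothesis.Theorems.IntegerScrewCensusDualWalk

/-!
# Route `IntegerScrew` — kernel checker for the census DUAL certificates (2b): width-aware slacks

The frequency of a pair term is read from the log table as `f̃ = (L_a − L_b)/2^48` with `|f − f̃| ≤ 2·Wmax/2^48`
(`Wmax` = the largest enclosure width), so the frequency slack of the Taylor models is `Δ' = h·2Wmax/2^48 = Wmax/2^46`
and the third-derivative weights use `2^52 f ≤ φ + 16·Wmax`.  The drivers of `IntegerScrewCensusDualWalk` fixed
`Wmax ≤ 2` in these two places; this file re-defines them with the width as a parameter (`ampSumsW`, `slacksW`,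
`cellsGoW`, `dualCheckW`) so that the same checker is sound with the tree's log table `RungCert.logs127`
(`Wmax ≤ 2^14`) as well as with a sharp one.  Everything else (`nodeData`, `cellCheck`, `walkGo`, `dualLight`) is reused.
Pure arithmetic; RH-free; nothing here bears on the truth of RH.
-/

set_option linter.dupNamespace false
set_option autoImplicit false

namespace Summit.RiemannHypothesis.RiemannHypothesis.Theorems.IntegerScrew.Manifest.Fast

open Literature.Analysis.ValidatedNumerics Literature.Analysis.ValidatedNumerics.Numerics
open Literature.Analysis.ValidatedNumerics.KroneckerDot

/-- `Σ_{b<a} |A_ab|` and `Σ_{b<a} |A_ab| (φ_a − φ_b + 16·Wmax)³` for the lower part of one row (`A_ab = 2 Z_ab`). -/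
def ampRowW (Wm φa : ℕ) : List ℤ → List ℕ → ℕ × ℕ
  | z :: zs, φb :: φs =>
    let r := ampRowW Wm φa zs φs
    (r.1 + 2 * z.natAbs, r.2 + 2 * z.natAbs * (φa - φb + 16 * Wm) ^ 3)
  | _, _ => (0, 0)

/-- `Σ_f |A_f|` and `Σ_f |A_f| (φ_f + 16·Wmax)³` (`2^52 f ≤ φ_f + 16·Wmax` for every term frequency `f`). -/
def ampSumsW (Z : List (List ℤ)) (φs : List ℕ) (Wm : ℕ) : ℕ × ℕ :=
  let n := Z.length
  let rows := (List.range n).map fun a =>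
    let zr := Z.getD a []
    let φa := φs.getD a 0
    let An := 2 * (sumZ zr).natAbs
    let pr := ampRowW Wm φa (zr.take a) φs
    (An + pr.1, An * (φa + 16 * Wm) ^ 3 + pr.2)
  (sumN (rows.map (·.1)), sumN (rows.map (·.2)))

/-- The three slacks `(S0, S1, S2)` (scaled by `2^{RD}`) with the frequency slack `Δ' = Wmax/2^46`
(otherwise as `slacks`: `U = Un/(500·2^52)`, `δ = 31U ≤ del60/2^60`, `ρ = 2c₁^{D−1}/(D−1)! ≤ rho60/2^60`, `c₁ = C1N/2^52`):
`S0 ≥ 2^{RD}(K0 ΣA (δ(1+ρ) + ρ + Δ') + (D+1)2^105 ΣA)`, `S1 ≥ 2^{RD}·2·(K0 ΣA (c₁(δ(1+ρ)+ρ) + Δ'(1+c₁)) + (D+1)²2^105 ΣA)`,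
`S2 ≥ 2^{RD}·4·(K0 ΣA (c₁²(δ(1+ρ)+ρ) + Δ'(2c₁+c₁²)) + (D+2)³2^105 ΣA)`. -/
def slacksW (D E Un C1N sumA Wm : ℕ) : ℕ × ℕ × ℕ :=
  let K0 := K0N D E
  let rho60 := 2 * C1N ^ (D - 1) * 2 ^ 60 / (2 ^ (52 * (D - 1)) * Nat.factorial (D - 1)) + 1
  let del60 := 31 * Un * 2 ^ 8 / 500 + 1
  let dr := del60 * (2 ^ 60 + rho60) / 2 ^ 60 + 1 + rho60
  let dl := 2 ^ 14 * Wm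
  let b0 := dr + dl
  let b1 := C1N * dr / 2 ^ 52 + 1 + dl * (2 ^ 52 + C1N) / 2 ^ 52 + 1
  let b2 := C1N * C1N * dr / 2 ^ 104 + 1 + dl * (2 * C1N * 2 ^ 52 + C1N * C1N) / 2 ^ 104 + 1
  let fl := 2 ^ 105 * sumA
  (2 ^ (RB * D) * (K0 * sumA * b0 / 2 ^ 60 + 1 + (D + 1) * fl),
    2 ^ (RB * D) * 2 * (K0 * sumA * b1 / 2 ^ 60 + 1 + (D + 1) ^ 2 * fl),
    2 ^ (RB * D) * 4 * (K0 * sumA * b2 / 2 ^ 60 + 1 + (D + 2) ^ 3 * fl))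

/-- The cells `c = cFrom …` with the width-aware slacks (otherwise as `cellsGo`). -/
def cellsGoW (D E n lo Wm fuel : ℕ) (logs : List FI) (nds : List NodeD) (c0K : ℤ) (C1N sumA Lam : ℕ) : ℕ → ℕ → Bool
  | 0, _ => true
  | k + 1, c =>
    let j := 2000 * c + 1000
    let R := rows tcList logs 500 [j] n
    let vals := (R.1.drop 2).map fun dr => dr.2.getD 0 (0, 0)
    let S := slacksW D E (32 * j * Wm + 7000) C1N sumA Wm
    let mstart := if c = 0 then MR / 40 else 0
    let mend := if 4 * c + 4 ≤ lo then MR else MR * (lo - 4 * c) / 4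
    R.2 && cellCheck D (halfPack D) nds c0K S Lam vals mstart mend fuel &&
      cellsGoW D E n lo Wm fuel logs nds c0K C1N sumA Lam k (c + 1)

/-- **THE DUAL CHECKER** (width-aware): as `dualCheck` with `ampSumsW`/`slacksW` (log-table width `Wmax`). -/
def dualCheckW (n lo D E fuel cFrom cTo : ℕ) (logs : List FI) (pats : List (ℕ × ℕ × ℕ)) (epsN : ℕ) : Bool :=
  let Z := zMatrix n epsN pats
  let φs := phis logs n
  let cs := kConsts D E
  let nds := nodeData cs Z φs
  let Wm := maxLogWidth logs (n + 1)
  let amps := ampSumsW Z φs Wm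
  let φmax := 16 * ((logLoW logs (n + 1)).1 + Wm)
  let C1N := 2 * φmax + 64
  let c0K : ℤ := constQ Z * (K0N D E : ℕ)
  let Lam := lamOf D E amps.2
  cellsGoW D E n lo Wm fuel logs nds c0K C1N amps.1 Lam (cTo - cFrom) cFrom

end Summit.RiemannHypothesis.RiemannHypothesis.Theorems.IntegerScrew.Manifest.Fast
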